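import Mathlib
import HarnessLib
import Summits.Ventures.LatticeQCDFlow.Scaling.WorkExponentialMoments

/-!
# WorkGaussianTails — the Chernoff bounds of `Scaling/WorkExponentialMoments` optimised: Gaussian
# tails of the dissipated work `W − ΔF` about `½V̄` with variance `V̄ = ((1+θ̄)/(1−θ̄))·σ̄²/n`
# on both sides, for arbitrary relaxation layers

HONEST FRAMING: exact (Metropolis-corrected) sampling algorithms for lattice gauge theory;
figures of merit are autocorrelation/cost numbers at stated couplings and volumes; no
continuum-physics claim.

Venture `LatticeQCDFlow` (cell pub-lqcd), topic `Scaling`; FANOUT row 19 (`su2-snf`, GEN-6).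
OUR WORK (elementary), nothing cited as a fact.  Setting and hypotheses as in
`Scaling/WorkExponentialMoments` (uniform grid `c_k = k/n`, positive layers with unit row sums
`χ²`-contracting towards their targets with `ρ ≥ 0`, `|D x − D y| ≤ ΔD`, `Var_c(D) ≤ σ̄²` for all
`c`).  Fix a tilt budget `s̄ > 0` with `θ̄ := ρ·e^{(7s̄+2)ΔD/(4n)} < 1` and put
`V̄ := ((1+θ̄)/(1−θ̄))·σ̄²/n` (`= 2τ̄(θ̄)·σ̄²/n`, the AR(1) variance proxy at contraction `θ̄`).

* `theta_le_of_le` — the contraction factor `θ_{−s} = ρe^{(5s+2(s+1))ΔD/(4n)}` is monotone in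
  `s ∈ (0, s̄]`, and so is the MGF exponent's lag coefficient;
* **`upperTail_work_gaussian`** — for `½V̄ < x` with `(x − ½V̄)/V̄ ≤ s̄`:
  `P_F(W − ΔF ≥ x) ≤ exp(−(x − ½V̄)²/(2V̄))` (Chernoff at `s⋆ = (x − ½V̄)/V̄`);
* **`lowerTail_work_gaussian`** — for `½V̄ ≤ x` with `t⋆ = x/V̄ + ½ ≤ s̄` (Chernoff at `t⋆ ≥ 1`,
  admissible since `5t⋆ + 2(t⋆−1) ≤ 7s̄ + 2`): `P_F(W − ΔF ≤ −x) ≤ exp(−(x + ½V̄)²/(2V̄))` —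
  second-law "violations" beyond the scale `V̄` are Gaussian-rare about the mean `+½V̄`.

Reading (value-free): with ANY reversible relaxation layers the work of the `n`-step protocol is
Gaussian-concentrated about `ΔF + ½V̄` at the AR(1) scale `V̄ = 2τ̄σ̄²/n`, within the tilt window
`|t| ≤ s̄` where the sup-norm factors stay controlled.  NOT CLAIMED: tails beyond the window; any
value of `ρ`, `σ̄`, `ΔD` for a lattice kernel.
-/

namespace Summit.Ventures.LatticeQCDFlow.Scaling

open Finset
open Literature.Probability.MarkovChains (IsStationary)
open Summit.Ventures.LatticeQCDFlow.Exactness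
open Summit.Ventures.LatticeQCDFlow.Theory2

variable {X : Type*} [Fintype X] [Nonempty X]

/-- Monotonicity of the contraction factor's exponent: for `0 ≤ a ≤ b` and `ΔD ≥ 0`, `n > 0`,
`ρe^{aΔD/(4n)} ≤ ρe^{bΔD/(4n)}` (`ρ ≥ 0`). -/
theorem theta_le_of_le {ρ ΔD a b : ℝ} {n : ℕ} (hρ : 0 ≤ ρ) (hΔ : 0 ≤ ΔD) (hab : a ≤ b) :
    ρ * Real.exp (a * ΔD / (4 * n)) ≤ ρ * Real.exp (b * ΔD / (4 * n)) := by
  refine mul_le_mul_of_nonneg_left (Real.exp_le_exp.mpr ?_) hρ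
  rcases Nat.eq_zero_or_pos n with h | h
  · subst h; simp
  · have hn : (0 : ℝ) < 4 * n := by positivity
    exact div_le_div_of_nonneg_right (mul_le_mul_of_nonneg_right hab hΔ) hn.le

/-- **GAUSSIAN UPPER TAIL OF THE WORK.**  With `θ̄ = ρe^{(7s̄+2)ΔD/(4n)} < 1`,
`V̄ = ((1+θ̄)/(1−θ̄))·σ̄²/n`, for every `x` with `½V̄ < x` and `(x − ½V̄)/V̄ ≤ s̄`:
`P_F(W − ΔF ≥ x) ≤ exp(−(x − ½V̄)²/(2V̄))`. -/
theorem upperTail_work_gaussian (S₀ D : X → ℝ) (P : ℕ → X → X → ℝ) {n : ℕ} (hn : n ≠ 0)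
    {ΔD ρ σbar sbar x : ℝ} (hD : ∀ x y, |D x - D y| ≤ ΔD) (hPpos : ∀ k x y, 0 < P k x y)
    (hProw : ∀ k x, ∑ y, P k x y = 1)
    (hK : ∀ k, ChiSqContracts (P k) (gibbsLaw (linAction S₀ D (((k + 1 : ℕ) : ℝ) / n))) ρ)
    (hρ : 0 ≤ ρ) (hσ0 : 0 < σbar) (hσ : ∀ c, varD S₀ D c ≤ σbar ^ 2)
    (hθ1 : ρ * Real.exp ((7 * sbar + 2) * ΔD / (4 * n)) < 1)
    (hx : (1 + ρ * Real.exp ((7 * sbar + 2) * ΔD / (4 * n)))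
        / (1 - ρ * Real.exp ((7 * sbar + 2) * ΔD / (4 * n))) * (σbar ^ 2 / n) / 2 < x)
    (hxs : (x - (1 + ρ * Real.exp ((7 * sbar + 2) * ΔD / (4 * n)))
        / (1 - ρ * Real.exp ((7 * sbar + 2) * ΔD / (4 * n))) * (σbar ^ 2 / n) / 2)
        / ((1 + ρ * Real.exp ((7 * sbar + 2) * ΔD / (4 * n)))
          / (1 - ρ * Real.exp ((7 * sbar + 2) * ΔD / (4 * n))) * (σbar ^ 2 / n)) ≤ sbar) :
    ∑ ω : Fin (n + 1) → X,
        (if x ≤ work (fun k : Fin (n + 1) => linAction S₀ D ((k : ℝ) / n)) ω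
              - (linFreeEnergy S₀ D 1 - linFreeEnergy S₀ D 0)
          then pathLaw (gibbsLaw (linAction S₀ D (((0 : ℕ) : ℝ) / n))) (fun k : Fin n => P k) ω
          else 0)
      ≤ Real.exp (-((x - (1 + ρ * Real.exp ((7 * sbar + 2) * ΔD / (4 * n)))
          / (1 - ρ * Real.exp ((7 * sbar + 2) * ΔD / (4 * n))) * (σbar ^ 2 / n) / 2) ^ 2
          / (2 * ((1 + ρ * Real.exp ((7 * sbar + 2) * ΔD / (4 * n)))
            / (1 - ρ * Real.exp ((7 * sbar + 2) * ΔD / (4 * n))) * (σbar ^ 2 / n))))) := by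
  set θb := ρ * Real.exp ((7 * sbar + 2) * ΔD / (4 * n)) with hθb
  set V := (1 + θb) / (1 - θb) * (σbar ^ 2 / n) with hV
  have hn' : (0 : ℝ) < n := Nat.cast_pos.mpr (Nat.pos_of_ne_zero hn)
  have hΔ : 0 ≤ ΔD := (abs_nonneg _).trans (hD (Classical.arbitrary X) (Classical.arbitrary X))
  have hθb0 : 0 ≤ θb := by positivity
  have h1θ : 0 < 1 - θb := by linarith
  have hσn : 0 < σbar ^ 2 / n := by positivity
  have hV0 : 0 < V := by
    rw [hV]; exact mul_pos (div_pos (by linarith) h1θ) hσn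
  -- the Chernoff parameter
  set s := (x - V / 2) / V with hs
  have hs0 : 0 < s := div_pos (by linarith) hV0
  have hsb : s ≤ sbar := hxs
  -- θ_{-s} ≤ θ̄ and the envelope at s
  have hθs : ρ * Real.exp ((5 * s + 2 * (s + 1)) * ΔD / (4 * n)) ≤ θb :=
    theta_le_of_le hρ hΔ (by linarith)
  have hθs1 : ρ * Real.exp ((5 * s + 2 * (s + 1)) * ΔD / (4 * n)) < 1 := lt_of_le_of_lt hθs hθ1
  have htail := upperTail_work_le (x := x) S₀ D P hn hD hPpos hProw hK hρ hσ0.le hσ hs0 hθs1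
  refine htail.trans (Real.exp_le_exp.mpr ?_)
  have hlag : ρ * Real.exp ((5 * s + 2 * (s + 1)) * ΔD / (4 * n))
        / (1 - ρ * Real.exp ((5 * s + 2 * (s + 1)) * ΔD / (4 * n))) ≤ θb / (1 - θb) := by
    rw [div_le_div_iff₀ (by linarith) (by linarith)]; nlinarith
  have hss : 0 ≤ s * (s + 1) := by positivity
  -- exponent at s with θ̄: −s x + s(s+1) V/2 = −(x − V/2)²/(2V)
  have hkey : -(s * x) + (s * (s + 1) / 2 + s * (s + 1) * (θb / (1 - θb))) * (σbar ^ 2 / n)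
      = -((x - V / 2) ^ 2 / (2 * V)) := by
    have hVe : (1 / 2 + θb / (1 - θb)) * (σbar ^ 2 / n) = V / 2 := by
      rw [hV]; field_simp; ring
    have e1 : (s * (s + 1) / 2 + s * (s + 1) * (θb / (1 - θb))) * (σbar ^ 2 / n)
        = s * (s + 1) * ((1 / 2 + θb / (1 - θb)) * (σbar ^ 2 / n)) := by ring
    rw [e1, hVe, hs]
    field_simp
    ring
  calc -(s * x) + (s * (s + 1) / 2 + s * (s + 1)
          * (ρ * Real.exp ((5 * s + 2 * (s + 1)) * ΔD / (4 * n))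
            / (1 - ρ * Real.exp ((5 * s + 2 * (s + 1)) * ΔD / (4 * n))))) * (σbar ^ 2 / n)
      ≤ -(s * x) + (s * (s + 1) / 2 + s * (s + 1) * (θb / (1 - θb))) * (σbar ^ 2 / n) := by
        have := mul_le_mul_of_nonneg_left hlag hss
        nlinarith [this, hσn]
    _ = -((x - V / 2) ^ 2 / (2 * V)) := hkey

/-- **GAUSSIAN LOWER TAIL OF THE WORK** (second-law "violations").  With `θ̄`, `V̄` as above
(`θ̄ = ρe^{(7s̄+2)ΔD/(4n)} < 1`, `s̄ ≥ 1`), for every `x ≥ ½V̄` whose tilt `t⋆ = x/V̄ + ½` is at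
most `s̄`: `P_F(W − ΔF ≤ −x) ≤ exp(−(x + ½V̄)²/(2V̄))`. -/
theorem lowerTail_work_gaussian (S₀ D : X → ℝ) (P : ℕ → X → X → ℝ) {n : ℕ} (hn : n ≠ 0)
    {ΔD ρ σbar sbar x : ℝ} (hD : ∀ x y, |D x - D y| ≤ ΔD) (hPpos : ∀ k x y, 0 < P k x y)
    (hProw : ∀ k x, ∑ y, P k x y = 1)
    (hK : ∀ k, ChiSqContracts (P k) (gibbsLaw (linAction S₀ D (((k + 1 : ℕ) : ℝ) / n))) ρ)
    (hρ : 0 ≤ ρ) (hσ0 : 0 < σbar) (hσ : ∀ c, varD S₀ D c ≤ σbar ^ 2)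
    (hθ1 : ρ * Real.exp ((7 * sbar + 2) * ΔD / (4 * n)) < 1)
    (hx : (1 + ρ * Real.exp ((7 * sbar + 2) * ΔD / (4 * n)))
        / (1 - ρ * Real.exp ((7 * sbar + 2) * ΔD / (4 * n))) * (σbar ^ 2 / n) / 2 ≤ x)
    (hxs : x / ((1 + ρ * Real.exp ((7 * sbar + 2) * ΔD / (4 * n)))
          / (1 - ρ * Real.exp ((7 * sbar + 2) * ΔD / (4 * n))) * (σbar ^ 2 / n)) + 1 / 2 ≤ sbar) :
    ∑ ω : Fin (n + 1) → X,
        (if x ≤ -(work (fun k : Fin (n + 1) => linAction S₀ D ((k : ℝ) / n)) ω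
              - (linFreeEnergy S₀ D 1 - linFreeEnergy S₀ D 0))
          then pathLaw (gibbsLaw (linAction S₀ D (((0 : ℕ) : ℝ) / n))) (fun k : Fin n => P k) ω
          else 0)
      ≤ Real.exp (-((x + (1 + ρ * Real.exp ((7 * sbar + 2) * ΔD / (4 * n)))
          / (1 - ρ * Real.exp ((7 * sbar + 2) * ΔD / (4 * n))) * (σbar ^ 2 / n) / 2) ^ 2
          / (2 * ((1 + ρ * Real.exp ((7 * sbar + 2) * ΔD / (4 * n)))
            / (1 - ρ * Real.exp ((7 * sbar + 2) * ΔD / (4 * n))) * (σbar ^ 2 / n))))) := by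
  set θb := ρ * Real.exp ((7 * sbar + 2) * ΔD / (4 * n)) with hθb
  set V := (1 + θb) / (1 - θb) * (σbar ^ 2 / n) with hV
  have hn' : (0 : ℝ) < n := Nat.cast_pos.mpr (Nat.pos_of_ne_zero hn)
  have hΔ : 0 ≤ ΔD := (abs_nonneg _).trans (hD (Classical.arbitrary X) (Classical.arbitrary X))
  have hθb0 : 0 ≤ θb := by positivity
  have h1θ : 0 < 1 - θb := by linarith
  have hσn : 0 < σbar ^ 2 / n := by positivity
  have hV0 : 0 < V := by
    rw [hV]; exact mul_pos (div_pos (by linarith) h1θ) hσn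
  set t := x / V + 1 / 2 with ht
  have ht1 : 1 ≤ t := by
    rw [ht]
    have : 1 / 2 ≤ x / V := by rw [le_div_iff₀ hV0]; linarith
    linarith
  have ht0 : 0 < t := by linarith
  have htb : t ≤ sbar := hxs
  have habs_t : |t| = t := abs_of_pos ht0
  have habs_t1 : |t - 1| = t - 1 := abs_of_nonneg (by linarith)
  have hθt : ρ * Real.exp ((5 * |t| + 2 * |t - 1|) * ΔD / (4 * n)) ≤ θb := by
    rw [habs_t, habs_t1]; exact theta_le_of_le hρ hΔ (by linarith)
  have hθt1 : ρ * Real.exp ((5 * |t| + 2 * |t - 1|) * ΔD / (4 * n)) < 1 := lt_of_le_of_lt hθt hθ1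
  have htail := lowerTail_work_le (x := x) S₀ D P hn hD hPpos hProw hK hρ hσ0.le hσ ht0 hθt1
  refine htail.trans (Real.exp_le_exp.mpr ?_)
  have hlag : ρ * Real.exp ((5 * |t| + 2 * |t - 1|) * ΔD / (4 * n))
        / (1 - ρ * Real.exp ((5 * |t| + 2 * |t - 1|) * ΔD / (4 * n))) ≤ θb / (1 - θb) := by
    rw [div_le_div_iff₀ (by linarith) (by linarith)]; nlinarith
  have htt : 0 ≤ t * (t - 1) := mul_nonneg ht0.le (by linarith)
  have hmax : max (t * (t - 1)) 0 = t * (t - 1) := max_eq_left htt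
  have habs : |t * (t - 1)| = t * (t - 1) := abs_of_nonneg htt
  rw [hmax, habs]
  have hkey : -(t * x) + (t * (t - 1) / 2 + t * (t - 1) * (θb / (1 - θb))) * (σbar ^ 2 / n)
      = -((x + V / 2) ^ 2 / (2 * V)) := by
    have hVe : (1 / 2 + θb / (1 - θb)) * (σbar ^ 2 / n) = V / 2 := by
      rw [hV]; field_simp; ring
    have e1 : (t * (t - 1) / 2 + t * (t - 1) * (θb / (1 - θb))) * (σbar ^ 2 / n)
        = t * (t - 1) * ((1 / 2 + θb / (1 - θb)) * (σbar ^ 2 / n)) := by ring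
    rw [e1, hVe, ht]
    field_simp
    ring
  calc -(t * x) + (t * (t - 1) / 2 + t * (t - 1)
          * (ρ * Real.exp ((5 * |t| + 2 * |t - 1|) * ΔD / (4 * n))
            / (1 - ρ * Real.exp ((5 * |t| + 2 * |t - 1|) * ΔD / (4 * n))))) * (σbar ^ 2 / n)
      ≤ -(t * x) + (t * (t - 1) / 2 + t * (t - 1) * (θb / (1 - θb))) * (σbar ^ 2 / n) := by
        have := mul_le_mul_of_nonneg_left hlag htt
        nlinarith [this, hσn]
    _ = -((x + V / 2) ^ 2 / (2 * V)) := hkey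

end Summit.Ventures.LatticeQCDFlow.Scaling
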